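import Mathlib.Analysis.SpecialFunctions.Log.Base
import Mathlib.Analysis.SpecialFunctions.Pow.Real
import Mathlib.Analysis.SpecialFunctions.Sqrt
import Mathlib.InformationTheory.Hamming
import Literature.InformationTheory.QuantumCodes.LocalCodeTradeoffTorus
import HarnessLib

/-!
# Bravyi–Poulin–Terhal 2010, Eq. (3): `k ≤ c n/√d` for 2D classical codes with local constraints — proof

S. Bravyi, D. Poulin, B. Terhal, *Tradeoffs for reliable quantum information storage in 2D systems*, Phys. Rev.
Lett. 104 (2010) 050503 = arXiv:0909.5200 [BravyiPoulinTerhal2010], p. 2 (chunk p0003 L40–45): «One can also ask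
about the analogue of the tradeoff Eq. (1) for classical information storage. In Appendix A we prove that any 2D
classical code specified by geometrically local constraints obeys the bound `k ≤ c n/√d` (3). Here `c` is a constant
depending only on the dimension of individual particles and locality of the constraints specifying the code.»
(Abstract, p0002 L14: «the analogous tradeoff for classical information storage is `k√d = O(n)`».) Appendix A
(p0007 L7–34): «each site of the lattice `u ∈ Λ` is occupied by a classical variable `x_u` that can take a constant
number of values. The codespace `𝒞` is a set of all assignments `x = {x_u}` that obey geometrically local constraints
`Π_1(x) = 1, …, Π_m(x) = 1`. A code encodes `k` bits with the distance `d` iff `|𝒞| = 2^k` and any pair of distinct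
codewords differ at `d` or more sites. Consider a partition `Λ = AB`, where `B = B_1 … B_m` consists of square-shaped
blocks of size roughly `√d × √d` such that the number of sites in any block `B_i` is smaller than `d` … the separation
between the blocks in `B` is of order `w`, so that any constraint `Π_a` overlaps with at most one block `B_i`. Let
`x, y ∈ 𝒞` be any pair of codewords such that `x|_A = y|_A`. We claim that `x = y`. Indeed, suppose `x` and `y` differ
at some block `B_i`. Then there exists a codeword `z ∈ 𝒞` that coincides with `x` inside `B_i` and coincides with `y`
in the complement of `B_i`. It means that `z` and `y` are distinct codewords that differ at less than `d` sites which
is a contradiction. … `k = S(ρ) = S(A) + S(B|A) = S(A) ≤ |A| ∼ n/d^{1/2}`.»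

THIS FILE PROVES Eq. (3) on the `L × L` TORUS (the Letter's footnote: «regular `D`-dimensional cubic lattice with open
or periodic boundary conditions») and, as a corollary, with open boundaries: for every alphabet size `q` and range
`w` there is `c = c(q, w) > 0` such that for every code `𝒞 ⊆ (Fin n → Fin q)` on `n = L²` sites placed on the torus
by `e`, cut out by constraints each depending only on the sites of one `w × w` window (modulo `L`), in which distinct
codewords differ in at least `d` sites, `log₂|𝒞| · √d ≤ c · n` (`BravyiPoulinTerhal2010_classical_torus`,
`BravyiPoulinTerhal2010_classical`; the product form avoids the junk value of `n/√d` at `d = 0`). The constant is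
`c = 12 (max w 2 − 1)(log₂ q + 1)`.

## Proof (Appendix A as printed, on the near-equal cyclic periods of `LocalCodeTradeoffTorus.lean`)

With `t = max(w,2) − 1`, `s = ⌊√(d−1)⌋` (so `s² < d ≤ (s+1)²`) and `p = s + t`, cut each circle factor of the torus into
`Q = ⌈L/p⌉` periods (`BPTTorus.per`); the blocks `B_{ij}` are the products of the non-corridor columns of two periods
(at most `s × s < d` sites, `BPTTorus.block_offset`), `A` = sites with a corridor coordinate (`|A| ≤ 2 · 3tQ · L`,
`BPTTorus.card_badFin_le`). A constraint window of range `t + 1` that meets a block meets no other block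
(`BPTTorus.per_eq_of_close_of_not_isCorr`), so the hybrid word `z = (x on B_{ij}, y elsewhere)` satisfies every
constraint when `x, y ∈ 𝒞` agree on `A` — this is the printed injectivity of `x ↦ x|_A`, whence `|𝒞| ≤ q^{|A|}` and
`log₂|𝒞| · √d ≤ |A| log₂ q · (s+1) ≤ 12 t n log₂ q`; tori smaller than `6t`, blocks smaller than `5t` and codes
with fewer than two words are the degenerate regimes (`|𝒞| ≤ q^n`, `d ≤ n`).

Deliberately NOT here: other lattice geometries, a `D`-dimensional version (not printed), linear structure of the
code (not needed), the cellular-automaton codes of Appendix A that nearly saturate the bound (a construction, not a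
bound), any attempt at a good constant.

## References

* [BravyiPoulinTerhal2010] arXiv:0909.5200, read via `lit`: Eq. (3) and its announcement (chunk p0003 L40–45),
  abstract (p0002 L14), Appendix A (p0007 L1–34), footnote on boundary conditions (p0003 L24–26).

## Mathlib / tree search

Tree: `BPTTorus.per`, `BPTTorus.IsCorr`, `BPTTorus.badFin`, `BPTTorus.card_badFin_le`, `BPTTorus.block_offset`,
`BPTTorus.pstart_le_of_per_eq`, `BPTTorus.per_eq_of_close_of_not_isCorr`, `BPTTorus.close_of_inCubePeriodic`,
`BPTTorus.IsCorr.bad`, `InCube.toPeriodic` (LocalCodeTradeoffTorus.lean); `InCubePeriodic`, `InCube`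
(LocalityBounds.lean). Mathlib: `hammingDist`, `Real.logb`, `Real.sqrt`, `Nat.sqrt`, `Fintype.card_piFinset`,
`Finset.card_le_card_of_injOn`.
-/

namespace Literature.InformationTheory.QuantumCodes

open Finset
open Classical

namespace BPTClassical

open BPTTorus

variable {L n q : ℕ}

/-! ### The block of a site and the region `A` -/

/-- A site has a **corridor coordinate** (it belongs to the region `A` of Appendix A, the complement of the blocks).
[cite: BravyiPoulinTerhal2010, Appendix A («Consider a partition Λ = AB»)] -/
def InA (e : Fin n ≃ (Fin 2 → Fin L)) (Q t : ℕ) (u : Fin n) : Prop :=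
  ∃ j, IsCorr L Q t (e u j : ℕ)

/-- Two sites lie in the **same block** `B_i`: no corridor coordinate, and the same period in both directions.
[cite: BravyiPoulinTerhal2010, Appendix A («B = B_1 … B_m consists of square-shaped blocks»)] -/
def SameBlock (e : Fin n ≃ (Fin 2 → Fin L)) (Q t : ℕ) (u v : Fin n) : Prop :=
  ¬ InA e Q t v ∧ ∀ j, per L Q (e v j : ℕ) = per L Q (e u j : ℕ)

variable {e : Fin n ≃ (Fin 2 → Fin L)} {Q t : ℕ}

/-- **A block has fewer than `d` sites**: the block of `u` lies in an `s × s` square, `s = p − t` the block width.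
[cite: BravyiPoulinTerhal2010, Appendix A («the number of sites in any block B_i is smaller than d»)] -/
theorem card_filter_sameBlock_le (hQ : 0 < Q) (hL : 0 < L) {p : ℕ} (hLQ : L ≤ Q * p) (u : Fin n) :
    #(univ.filter fun v => SameBlock e Q t u v) ≤ (p - t) ^ 2 := by
  -- the block maps injectively into [pstart P0, pstart P0 + s) × [pstart P1, pstart P1 + s)
  have hsub : ∀ v ∈ (univ.filter fun v => SameBlock e Q t u v), ∀ j,
      pstart L Q (per L Q (e u j : ℕ)) ≤ (e v j : ℕ) ∧
        (e v j : ℕ) < pstart L Q (per L Q (e u j : ℕ)) + (p - t) := by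
    intro v hv j
    rw [mem_filter] at hv
    obtain ⟨hA, hper⟩ := hv.2
    have hnc : ¬ IsCorr L Q t (e v j : ℕ) := fun h => hA ⟨j, h⟩
    have hb := block_offset (t := t) hQ hL hLQ hnc (hper j)
    constructor
    · exact hb.1
    · omega
  calc #(univ.filter fun v => SameBlock e Q t u v)
      ≤ #((Finset.Ico (pstart L Q (per L Q (e u 0 : ℕ))) (pstart L Q (per L Q (e u 0 : ℕ)) + (p - t))) ×ˢ
          (Finset.Ico (pstart L Q (per L Q (e u 1 : ℕ))) (pstart L Q (per L Q (e u 1 : ℕ)) + (p - t)))) := by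
        refine card_le_card_of_injOn (fun v => ((e v 0 : ℕ), (e v 1 : ℕ))) ?_ ?_
        · intro v hv
          have h0 := hsub v (mem_coe.1 hv) 0
          have h1 := hsub v (mem_coe.1 hv) 1
          simp only [coe_product, Set.mem_prod, mem_coe, Finset.mem_Ico]
          exact ⟨h0, h1⟩
        · intro v _ v' _ h
          simp only [Prod.mk.injEq] at h
          apply e.injective
          funext j
          fin_cases j
          · exact Fin.ext h.1
          · exact Fin.ext h.2
    _ = (p - t) ^ 2 := by rw [card_product, Nat.card_Ico, Nat.card_Ico, Nat.add_sub_cancel_left,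
        Nat.add_sub_cancel_left, pow_two]

/-- **`|A| ≤ 6tQ·L`**: a site of `A` has a corridor (hence bad) coordinate; at most `3tQ` columns are bad.
[cite: BravyiPoulinTerhal2010, Appendix A («S(A) ≤ |A| ∼ n/d^{1/2}»)] -/
theorem card_filter_inA_le (hQ : 0 < Q) (hL : 0 < L) (h2 : 2 * t * Q ≤ L) :
    #(univ.filter fun u => InA e Q t u) ≤ 2 * (3 * t * Q) * L := by
  haveI : NeZero L := ⟨hL.ne'⟩
  have hbad := card_badFin_le (L := L) (t := t) hQ hL h2
  have hcol : ∀ j : Fin 2, #(univ.filter fun u : Fin n => IsCorr L Q t (e u j : ℕ)) ≤ 3 * t * Q * L := by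
    intro j
    have h := card_filter_sub_mem (e := e) hL (fun _ => (0 : Fin L))
      (fun i => if i = j then badFin L Q t else univ)
    have hsubset : (univ.filter fun u : Fin n => IsCorr L Q t (e u j : ℕ)) ⊆
        univ.filter fun u : Fin n => ∀ i, e u i - (fun _ => (0 : Fin L)) i ∈
          (fun i => if i = j then badFin L Q t else univ) i := by
      intro u hu
      simp only [mem_filter, mem_univ, true_and, sub_zero] at hu ⊢
      intro i
      split_ifs with hi
      · subst hi; simpa [badFin] using hu.bad
      · exact mem_univ _
    refine (card_le_card hsubset).trans ?_
    rw [h]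
    simp_rw [apply_ite Finset.card]
    rw [Finset.prod_ite, prod_const, prod_const, card_univ, Fintype.card_fin]
    have hc1 : #(univ.filter fun i : Fin 2 => i = j) = 1 := by
      rw [show (univ.filter fun i : Fin 2 => i = j) = {j} by ext i; simp]
      exact card_singleton j
    have hc2 : #(univ.filter fun i : Fin 2 => ¬ i = j) = 1 := by
      rw [filter_not, card_sdiff_of_subset (filter_subset _ _), hc1, card_univ, Fintype.card_fin]
    rw [hc1, hc2, pow_one, pow_one]
    exact Nat.mul_le_mul_right _ hbad
  calc #(univ.filter fun u => InA e Q t u)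
      ≤ #((univ.filter fun u : Fin n => IsCorr L Q t (e u 0 : ℕ)) ∪
          (univ.filter fun u : Fin n => IsCorr L Q t (e u 1 : ℕ))) := by
        refine card_le_card fun u hu => ?_
        simp only [mem_filter, mem_univ, true_and, InA] at hu
        obtain ⟨j, hj⟩ := hu
        rw [mem_union, mem_filter, mem_filter]
        fin_cases j
        · exact Or.inl ⟨mem_univ _, hj⟩
        · exact Or.inr ⟨mem_univ _, hj⟩
    _ ≤ 3 * t * Q * L + 3 * t * Q * L := (card_union_le _ _).trans (add_le_add (hcol 0) (hcol 1))
    _ = 2 * (3 * t * Q) * L := by ring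

/-- **Any constraint window meets at most one block**: two sites of one periodic window of range `t + 1`, neither in
`A`, lie in the same block. [cite: BravyiPoulinTerhal2010, Appendix A («any constraint Π_a overlaps with at most one block B_i»)] -/
theorem sameBlock_of_window {c : Fin 2 → Fin L} {u v : Fin n}
    (hu : InCubePeriodic (t + 1) c (e u)) (hv : InCubePeriodic (t + 1) c (e v)) (huA : ¬ InA e Q t u)
    (hvA : ¬ InA e Q t v) : SameBlock e Q t u v := by
  refine ⟨hvA, fun j => ?_⟩
  have hcl := close_of_inCubePeriodic (e := e) hv hu j
  exact per_eq_of_close_of_not_isCorr (fun h => hvA ⟨j, h⟩) (fun h => huA ⟨j, h⟩) hcl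

end BPTClassical

open BPTClassical BPTTorus

/-! ### Local constraints and the injectivity of restriction to `A` -/

section Codes

variable {L n q : ℕ}

/-- A constraint `P` on assignments `Fin n → Fin q` is **`w`-local (periodic window with corner `c`)**: it depends only
on the values at the sites of the window. [cite: BravyiPoulinTerhal2010, Appendix A («geometrically local constraints Π_1(x) = 1, …, Π_m(x) = 1»)] -/
def IsLocalConstraintPeriodic (e : Fin n ≃ (Fin 2 → Fin L)) (w : ℕ) (P : (Fin n → Fin q) → Prop) : Prop :=
  ∃ c : Fin 2 → Fin L, ∀ x y : Fin n → Fin q, (∀ u, InCubePeriodic w c (e u) → x u = y u) → (P x ↔ P y)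

/-- `w`-local constraint with an open-boundary window. [cite: BravyiPoulinTerhal2010, Appendix A] -/
def IsLocalConstraint (e : Fin n ≃ (Fin 2 → Fin L)) (w : ℕ) (P : (Fin n → Fin q) → Prop) : Prop :=
  ∃ c : Fin 2 → Fin L, ∀ x y : Fin n → Fin q, (∀ u, InCube w c (e u) → x u = y u) → (P x ↔ P y)

/-- An open-boundary window lies in the periodic window with the same corner, so an open-local constraint is
torus-local. [cite: BravyiPoulinTerhal2010, p. 2 footnote («open or periodic boundary conditions»)] -/
theorem IsLocalConstraint.toPeriodic {e : Fin n ≃ (Fin 2 → Fin L)} {w : ℕ} {P : (Fin n → Fin q) → Prop}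
    (h : IsLocalConstraint e w P) : IsLocalConstraintPeriodic e w P := by
  obtain ⟨c, hc⟩ := h
  exact ⟨c, fun x y hxy => hc x y fun u hu => hxy u hu.toPeriodic⟩

/-- Locality is monotone in the range. [cite: BravyiPoulinTerhal2010, Definitions and notations (p. 2: interaction range w)] -/
theorem IsLocalConstraintPeriodic.mono {e : Fin n ≃ (Fin 2 → Fin L)} {w w' : ℕ} (hw : w ≤ w')
    {P : (Fin n → Fin q) → Prop} (h : IsLocalConstraintPeriodic e w P) : IsLocalConstraintPeriodic e w' P := by
  obtain ⟨c, hc⟩ := h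
  exact ⟨c, fun x y hxy => hc x y fun u hu => hxy u (hu.mono hw)⟩

variable {e : Fin n ≃ (Fin 2 → Fin L)} {t Q : ℕ} {ι : Type*} {P : ι → (Fin n → Fin q) → Prop}
  {C : Finset (Fin n → Fin q)} {d : ℕ}

/-- **The hybrid codeword.** If every constraint is `(t+1)`-local on the torus, `x, y ∈ 𝒞` agree on `A`, and `u ∉ A`,
then `z = (x on the block of u, y elsewhere)` satisfies every constraint («there exists a codeword `z ∈ 𝒞` that
coincides with `x` inside `B_i` and coincides with `y` in the complement of `B_i`»).
[cite: BravyiPoulinTerhal2010, Appendix A] -/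
theorem BPTClassical.hybrid_mem (hP : ∀ a, IsLocalConstraintPeriodic e (t + 1) (P a))
    (hC : ∀ x, x ∈ C ↔ ∀ a, P a x) {x y : Fin n → Fin q} (hx : x ∈ C) (hy : y ∈ C)
    (hxy : ∀ v, InA e Q t v → x v = y v) (u : Fin n) :
    (fun v => if SameBlock e Q t u v then x v else y v) ∈ C := by
  rw [hC]
  intro a
  obtain ⟨c, hc⟩ := hP a
  by_cases hmeet : ∃ v, InCubePeriodic (t + 1) c (e v) ∧ SameBlock e Q t u v
  · -- the window meets the block of u: on the window z = x
    obtain ⟨v₀, hv₀, hv₀B⟩ := hmeet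
    have key : ∀ v, InCubePeriodic (t + 1) c (e v) → (if SameBlock e Q t u v then x v else y v) = x v := by
      intro v hv
      by_cases hvA : InA e Q t v
      · have : ¬ SameBlock e Q t u v := fun h => h.1 hvA
        rw [if_neg this, hxy v hvA]
      · have hvB : SameBlock e Q t u v := by
          have h1 := sameBlock_of_window (Q := Q) hv₀ hv hv₀B.1 hvA
          exact ⟨hvA, fun j => (h1.2 j).trans (hv₀B.2 j)⟩
        rw [if_pos hvB]
    exact (hc _ _ key).2 ((hC x).1 hx a)
  · -- the window misses the block: on the window z = y
    push Not at hmeet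
    have key : ∀ v, InCubePeriodic (t + 1) c (e v) → (if SameBlock e Q t u v then x v else y v) = y v := by
      intro v hv
      rw [if_neg (hmeet v hv)]
    exact (hc _ _ key).2 ((hC y).1 hy a)

/-- **Restriction to `A` is injective on the code** when every block has fewer than `d` sites («Let `x, y ∈ 𝒞` be any
pair of codewords such that `x|_A = y|_A`. We claim that `x = y`.»). [cite: BravyiPoulinTerhal2010, Appendix A] -/
theorem BPTClassical.eq_of_agree_on_A (hP : ∀ a, IsLocalConstraintPeriodic e (t + 1) (P a))
    (hC : ∀ x, x ∈ C ↔ ∀ a, P a x) (hd : ∀ x ∈ C, ∀ y ∈ C, x ≠ y → d ≤ hammingDist x y)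
    (hblock : ∀ u, #(univ.filter fun v => SameBlock e Q t u v) < d) {x y : Fin n → Fin q} (hx : x ∈ C)
    (hy : y ∈ C) (hxy : ∀ v, InA e Q t v → x v = y v) : x = y := by
  by_contra hne
  obtain ⟨u, hu⟩ : ∃ u, x u ≠ y u := by
    by_contra h
    push Not at h
    exact hne (funext h)
  have huA : ¬ InA e Q t u := fun h => hu (hxy u h)
  set z : Fin n → Fin q := fun v => if SameBlock e Q t u v then x v else y v with hz
  have hzC : z ∈ C := hybrid_mem hP hC hx hy hxy u
  have huu : SameBlock e Q t u u := ⟨huA, fun _ => rfl⟩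
  have hzy : z ≠ y := by
    intro h
    have := congrFun h u
    simp only [hz, if_pos huu] at this
    exact hu this
  have h1 := hd z hzC y hy hzy
  -- z and y differ only on the block of u
  have h2 : hammingDist z y ≤ #(univ.filter fun v => SameBlock e Q t u v) := by
    unfold hammingDist
    refine card_le_card fun v hv => ?_
    simp only [mem_filter, mem_univ, true_and] at hv ⊢
    by_contra hB
    simp only [hz, if_neg hB, ne_eq, not_true_eq_false] at hv
  have := hblock u
  omega

/-- **`|𝒞| ≤ q^{|A|}`**: the code injects into the assignments on `A` («there is a unique way to extend a codeword from
`A` to `B`», `k = S(A) ≤ |A|`). [cite: BravyiPoulinTerhal2010, Appendix A] -/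
theorem BPTClassical.card_code_le_pow_card_A (hP : ∀ a, IsLocalConstraintPeriodic e (t + 1) (P a))
    (hC : ∀ x, x ∈ C ↔ ∀ a, P a x) (hd : ∀ x ∈ C, ∀ y ∈ C, x ≠ y → d ≤ hammingDist x y)
    (hblock : ∀ u, #(univ.filter fun v => SameBlock e Q t u v) < d) (hq : 0 < q) :
    #C ≤ q ^ #(univ.filter fun u => InA e Q t u) := by
  haveI : NeZero q := ⟨hq.ne'⟩
  set A := univ.filter fun u => InA e Q t u with hA
  set T : Finset (Fin n → Fin q) := Fintype.piFinset fun u => if u ∈ A then univ else {0} with hT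
  have hTcard : #T = q ^ #A := by
    rw [hT, Fintype.card_piFinset]
    simp_rw [apply_ite Finset.card]
    rw [Finset.prod_ite, prod_const, prod_const, card_univ, Fintype.card_fin, card_singleton, one_pow, mul_one,
      Finset.filter_univ_mem]
  rw [← hTcard]
  refine card_le_card_of_injOn (fun x => fun u => if u ∈ A then x u else 0) ?_ ?_
  · intro x _
    simp only [hT, mem_coe, Fintype.mem_piFinset]
    intro u
    split_ifs <;> simp
  · intro x hx y hy hres
    apply eq_of_agree_on_A hP hC hd hblock (mem_coe.1 hx) (mem_coe.1 hy)
    intro v hv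
    have hvA : v ∈ A := by rw [hA]; exact mem_filter.2 ⟨mem_univ _, hv⟩
    have := congrFun hres v
    simpa [if_pos hvA] using this

end Codes

/-! ### Counting: `|𝒞| ≤ q^M`, `d ≤ B²`, `M·B ≤ 12 t n` -/

section Count

variable {L n q : ℕ} {ι : Type*} {P : ι → (Fin n → Fin q) → Prop} {C : Finset (Fin n → Fin q)} {d : ℕ}

/-- **The integer form of Eq. (3) on the torus.** For a code with at least two words cut out by `(t+1)`-local
constraints on the `L × L` torus there are `M, B` with `|𝒞| ≤ q^M`, `d ≤ B²` and `M·B ≤ 12 t n`: in the generic regime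
`M` bounds `|A|` (`≤ 6tQL`) and `B = s + 1 ≥ √d` with blocks of side `s = ⌊√(d−1)⌋`; tori smaller than `6t`, distances
below `(5t)²` and tori smaller than one period are the degenerate regimes.
[cite: BravyiPoulinTerhal2010, Appendix A («k = S(A) ≤ |A| ∼ n/d^{1/2}»)] -/
theorem BPTClassical.exists_count {t : ℕ} (ht : 1 ≤ t) (hq : 0 < q) (e : Fin n ≃ (Fin 2 → Fin L))
    (hP : ∀ a, IsLocalConstraintPeriodic e (t + 1) (P a)) (hC : ∀ x, x ∈ C ↔ ∀ a, P a x)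
    (hd : ∀ x ∈ C, ∀ y ∈ C, x ≠ y → d ≤ hammingDist x y) (h2 : 2 ≤ #C) :
    ∃ M B : ℕ, #C ≤ q ^ M ∧ d ≤ B ^ 2 ∧ M * B ≤ 12 * t * n := by
  have hn : n = L ^ 2 := by simpa using Fintype.card_congr e
  have hdn : d ≤ n := by
    obtain ⟨x, hx, y, hy, hxy⟩ := Finset.one_lt_card.1 h2
    exact (hd x hx y hy hxy).trans (hammingDist_le_card_fintype.trans (by simp))
  have hCn : #C ≤ q ^ n := by
    calc #C ≤ #(univ : Finset (Fin n → Fin q)) := card_le_univ C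
      _ = q ^ n := by simp
  have hL : 0 < L := by
    rcases Nat.eq_zero_or_pos L with h | h
    · exfalso
      rw [h] at hn
      simp only [ne_eq, OfNat.ofNat_ne_zero, not_false_eq_true, zero_pow] at hn
      subst hn
      have : #C ≤ 1 := (card_le_univ C).trans (by simp)
      omega
    · exact h
  -- tiny torus: M = n, B = L
  by_cases hLt : L < 6 * t
  · refine ⟨n, L, hCn, by nlinarith [hdn, hn], ?_⟩
    calc n * L ≤ n * (6 * t) := Nat.mul_le_mul_left _ hLt.le
      _ = 6 * t * n := by ring
      _ ≤ 12 * t * n := by nlinarith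
  rw [not_lt] at hLt
  -- small distance: M = n, B = 5t
  by_cases hds : d ≤ (5 * t) ^ 2
  · refine ⟨n, 5 * t, hCn, hds, ?_⟩
    calc n * (5 * t) = 5 * t * n := by ring
      _ ≤ 12 * t * n := by nlinarith
  rw [not_le] at hds
  -- blocks of side s = ⌊√(d−1)⌋
  set s := Nat.sqrt (d - 1) with hs
  have hsd : d ≤ (s + 1) ^ 2 := by
    have := Nat.lt_succ_sqrt (d - 1)
    rw [← hs, Nat.succ_eq_add_one] at this
    rw [pow_two]; omega
  have hssd : s * s < d := by
    have := Nat.sqrt_le (d - 1)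
    rw [← hs] at this
    omega
  have hs5 : 5 * t ≤ s := by
    have h1 : (5 * t) ^ 2 < (s + 1) ^ 2 := lt_of_lt_of_le hds hsd
    have := (Nat.pow_lt_pow_iff_left (by norm_num : (2 : ℕ) ≠ 0)).1 h1
    omega
  set p := s + t with hp
  have hp0 : 0 < p := by omega
  set Q := (L + p - 1) / p with hQdef
  have hQ1 : 1 ≤ Q := by
    rw [hQdef, Nat.le_div_iff_mul_le hp0]; omega
  have hdm := Nat.div_add_mod (L + p - 1) p
  have hml := Nat.mod_lt (L + p - 1) hp0
  have hLQ : L ≤ Q * p := by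
    have : p * ((L + p - 1) / p) = Q * p := by rw [hQdef]; ring
    omega
  have hQp : Q * p < L + p := by
    have : p * ((L + p - 1) / p) = Q * p := by rw [hQdef]; ring
    omega
  have hQone : L ≤ p → Q = 1 := by
    intro hpL
    have : Q < 2 := by
      by_contra h
      rw [not_lt] at h
      have : 2 * p ≤ Q * p := Nat.mul_le_mul_right _ h
      omega
    omega
  have h2Q : 2 * t * Q ≤ L := by
    rcases Nat.lt_or_ge p L with hpL | hpL
    · have h1 : 2 * t * (L + p) ≤ L * p :=
        calc 2 * t * (L + p) ≤ 2 * t * (L + L) := Nat.mul_le_mul_left _ (by omega)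
          _ = (4 * t) * L := by ring
          _ ≤ p * L := Nat.mul_le_mul_right _ (by omega)
          _ = L * p := by ring
      have h3 : 2 * t * Q * p < L * p :=
        calc 2 * t * Q * p = 2 * t * (Q * p) := by ring
          _ < 2 * t * (L + p) := Nat.mul_lt_mul_of_pos_left hQp (by omega)
          _ ≤ L * p := h1
      exact le_of_lt (Nat.lt_of_mul_lt_mul_right h3)
    · rw [hQone hpL]; omega
  have hQpos : 0 < Q := by omega
  -- blocks have fewer than d sites
  have hblock : ∀ u, #(univ.filter fun v => SameBlock e Q t u v) < d := fun u =>
    (card_filter_sameBlock_le (e := e) (t := t) hQpos hL hLQ u).trans_lt (by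
      rw [show p - t = s by omega, pow_two]; exact hssd)
  have hA := card_filter_inA_le (e := e) hQpos hL h2Q
  have hCA := card_code_le_pow_card_A hP hC hd hblock hq
  have hCM : #C ≤ q ^ (2 * (3 * t * Q) * L) := hCA.trans (Nat.pow_le_pow_right hq hA)
  rcases Nat.lt_or_ge p L with hpL | hpL
  · -- at least one period: B = s + 1
    refine ⟨2 * (3 * t * Q) * L, s + 1, hCM, hsd, ?_⟩
    have hQp2 : Q * p ≤ 2 * L := by omega
    calc 2 * (3 * t * Q) * L * (s + 1) ≤ 2 * (3 * t * Q) * L * p := Nat.mul_le_mul_left _ (by omega)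
      _ = 6 * t * L * (Q * p) := by ring
      _ ≤ 6 * t * L * (2 * L) := Nat.mul_le_mul_left _ hQp2
      _ = 12 * t * L ^ 2 := by ring
      _ = 12 * t * n := by rw [hn]
  · -- less than one period: B = L
    refine ⟨2 * (3 * t * Q) * L, L, hCM, by nlinarith [hdn, hn], ?_⟩
    rw [hQone hpL]
    calc 2 * (3 * t * 1) * L * L = 6 * t * L ^ 2 := by ring
      _ ≤ 12 * t * L ^ 2 := by nlinarith
      _ = 12 * t * n := by rw [hn]

end Count

/-! ### The theorems -/

/-- **Bravyi–Poulin–Terhal 2010, Eq. (3), on the 2D torus — proved.** «any 2D classical code specified by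
geometrically local constraints obeys the bound `k ≤ c n/√d` (3). Here `c` is a constant depending only on the
dimension of individual particles and locality of the constraints specifying the code.» For every alphabet size `q`
and range `w` there is `c = c(q,w) > 0` (here `c = 12 (max w 2 − 1)(log₂ q + 1)`) such that for every set of words
`𝒞 ⊆ (Fin n → Fin q)` on the `n = L²` sites of the `L × L` torus (placement `e`) which is cut out by constraints
`Π_a`, each depending only on the sites of one periodic `w × w` window, and in which distinct words differ in at
least `d` sites, `log₂|𝒞| · √d ≤ c · n` (i.e. `k ≤ c n/√d` with `|𝒞| = 2^k`; the product form has no junk value at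
`d = 0`). Column: proved theorem. [cite: BravyiPoulinTerhal2010, Eq. (3) (p. 2) with the footnote «open or periodic boundary conditions» and Appendix A (proof)] -/
theorem BravyiPoulinTerhal2010_classical_torus (q w : ℕ) :
    ∃ c : ℝ, 0 < c ∧ ∀ (L n : ℕ) (e : Fin n ≃ (Fin 2 → Fin L)) (ι : Type) (P : ι → (Fin n → Fin q) → Prop)
      (C : Finset (Fin n → Fin q)) (d : ℕ),
      (∀ a, IsLocalConstraintPeriodic e w (P a)) → (∀ x, x ∈ C ↔ ∀ a, P a x) →
      (∀ x ∈ C, ∀ y ∈ C, x ≠ y → d ≤ hammingDist x y) →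
        Real.logb 2 (#C) * Real.sqrt d ≤ c * n := by
  obtain ⟨t, ht, hwt⟩ : ∃ t : ℕ, 1 ≤ t ∧ w ≤ t + 1 := ⟨max w 2 - 1, by omega, by omega⟩
  have hlogq : 0 ≤ Real.logb 2 q := by
    rcases Nat.eq_zero_or_pos q with hq | hq
    · rw [hq, Nat.cast_zero, Real.logb_zero]
    · exact Real.logb_nonneg one_lt_two (by exact_mod_cast hq)
  refine ⟨12 * t * (Real.logb 2 q + 1), by positivity, ?_⟩
  intro L n e ι P C d hP hC hd
  have hP' : ∀ a, IsLocalConstraintPeriodic e (t + 1) (P a) := fun a => (hP a).mono hwt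
  have hrhs : (0 : ℝ) ≤ 12 * t * (Real.logb 2 q + 1) * n := by positivity
  by_cases h2 : #C < 2
  · -- fewer than two words: log₂|𝒞| = 0
    have hlog : Real.logb 2 (#C) = 0 := by
      interval_cases h : #C
      · rw [Nat.cast_zero, Real.logb_zero]
      · rw [Nat.cast_one, Real.logb_one]
    rw [hlog, zero_mul]
    exact hrhs
  rw [not_lt] at h2
  have hq : 0 < q := by
    rcases Nat.eq_zero_or_pos q with hq | hq
    · exfalso
      subst hq
      have : #C ≤ 1 := (card_le_univ C).trans (by
        rw [Fintype.card_fun, Fintype.card_fin, Fintype.card_fin]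
        rcases Nat.eq_zero_or_pos n with hn | hn
        · rw [hn, pow_zero]
        · rw [zero_pow (by omega)]; omega)
      omega
    · exact hq
  obtain ⟨M, B, hCM, hdB, hMB⟩ := BPTClassical.exists_count ht hq e hP' hC hd h2
  have hC0 : (0 : ℝ) < (#C : ℝ) := by exact_mod_cast (show 0 < #C by omega)
  have hlog : Real.logb 2 (#C) ≤ M * Real.logb 2 q := by
    calc Real.logb 2 (#C) ≤ Real.logb 2 ((q ^ M : ℕ) : ℝ) :=
          Real.logb_le_logb_of_le one_lt_two hC0 (by exact_mod_cast hCM)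
      _ = M * Real.logb 2 q := by rw [Nat.cast_pow, Real.logb_pow]
  have hsqrt : Real.sqrt d ≤ B := by
    calc Real.sqrt d ≤ Real.sqrt ((B : ℝ) ^ 2) := Real.sqrt_le_sqrt (by exact_mod_cast hdB)
      _ = B := Real.sqrt_sq (Nat.cast_nonneg B)
  have hMB' : ((M * B : ℕ) : ℝ) ≤ ((12 * t * n : ℕ) : ℝ) := by exact_mod_cast hMB
  calc Real.logb 2 (#C) * Real.sqrt d ≤ (M * Real.logb 2 q) * B :=
        mul_le_mul hlog hsqrt (Real.sqrt_nonneg _) (by positivity)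
    _ = ((M * B : ℕ) : ℝ) * Real.logb 2 q := by push_cast; ring
    _ ≤ ((12 * t * n : ℕ) : ℝ) * Real.logb 2 q := mul_le_mul_of_nonneg_right hMB' hlogq
    _ ≤ 12 * t * (Real.logb 2 q + 1) * n := by
        push_cast
        have hn0 : (0 : ℝ) ≤ n := Nat.cast_nonneg n
        have ht0 : (0 : ℝ) ≤ t := Nat.cast_nonneg t
        nlinarith [mul_nonneg ht0 hn0]

/-- **Bravyi–Poulin–Terhal 2010, Eq. (3), open boundaries**: the same for constraints each depending only on the sites
of one `w × w` window read inside `{0,…,L−1}²` (an open window lies in the periodic window with the same corner).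
[cite: BravyiPoulinTerhal2010, Eq. (3) (p. 2) and Appendix A] -/
theorem BravyiPoulinTerhal2010_classical (q w : ℕ) :
    ∃ c : ℝ, 0 < c ∧ ∀ (L n : ℕ) (e : Fin n ≃ (Fin 2 → Fin L)) (ι : Type) (P : ι → (Fin n → Fin q) → Prop)
      (C : Finset (Fin n → Fin q)) (d : ℕ),
      (∀ a, IsLocalConstraint e w (P a)) → (∀ x, x ∈ C ↔ ∀ a, P a x) →
      (∀ x ∈ C, ∀ y ∈ C, x ≠ y → d ≤ hammingDist x y) →
        Real.logb 2 (#C) * Real.sqrt d ≤ c * n := by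
  obtain ⟨c, hc, h⟩ := BravyiPoulinTerhal2010_classical_torus q w
  exact ⟨c, hc, fun L n e ι P C d hP hC hd => h L n e ι P C d (fun a => (hP a).toPeriodic) hC hd⟩

end Literature.InformationTheory.QuantumCodes
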